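import Mathlib
import Summits.AtomisticToContinuum.FouriersLaw.Theorems.FGRGap.Negative.OnsiteReduction
import Summits.AtomisticToContinuum.FouriersLaw.Theorems.EmbeddedDrudeMourreKineticConductivityFiniteAlgebra
import HarnessLib

/-!
# `EmbeddedDrudeMourre.KineticConductivityFinite` — `sin` is in the form domain; the variational
inverse of the current is positive

Helper file (supports item `stmt-AtomisticToContinuum-12599`, route `EmbeddedDrudeMourre`, sub-problem
`FouriersLaw`). The POSITIVITY half of the item: `0 < inverseForm ω₂ a b (currentVector ω₂)`, hence
`0 < kineticConductivity ω₂ a b T` (`T ≠ 0`), for `ω₂ > 0`, `a, b ≥ 0`.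

The point is that the trial function `sin` has FINITE Boltzmann form `q(sin) < ∞` although the
resolved collision kernel `w ∝ |ω'(k₂) - ω'(k₄)|⁻¹` is not integrable: by the exact identity
`sin_bracket_identity` of the companion file `…Algebra`, on the non-trivial resonant branch
`(sin k₁ + sin k₂ - sin k₃ - sin k₄)² = 16 ω(k₂)²ω(k₄)² (ω'(k₂) - ω'(k₄))² / (ω(k₂)+ω(k₄))²`, so every
term `w · (bracket)²` of the resolved energy delta is at most `8 · (9/16π) / ω₂³` (vertex `1`), the
fibre has at most twelve points (`mem_candidates`), and `q₁,₀(sin) ≤ ¼ (2π)² · 12 · 8 (9/16π) ω₂⁻³`;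
general couplings by `w_{a,b} ≤ (a+16b)² w_{1,0}` (`FGRGap.Negative.OnsiteReduction`). Positivity of
`⟨ω⁻² sin, sin⟩ = ∫ sin²/ω² ≥ π/(ω₂+4)` and the trial family `t · sin` in `le_inverseForm` finish.

References: Aoki–Lukkarinen–Spohn 2006, §4 (4.11)–(4.16) ("the singular denominator in (4.11) is
cancelled exactly").
-/

noncomputable section

open Real Set MeasureTheory
open scoped ENNReal

namespace Summit.AtomisticToContinuum.FouriersLaw.Theorems.KineticConductivityFinite

open Literature.MathematicalPhysics.KineticTheory.PhononBoltzmann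
open Summit.AtomisticToContinuum.FouriersLaw.Theorems.FGRGap.Negative.OnsiteReduction

/-! ### 1. Elementary bounds on the band -/

/-- `|sin k| ≤ ω(k)` (`ω₂ ≥ 0`): `ω² - sin² = ω₂ + (1 - cos k)² ≥ 0`. [folklore] -/
theorem abs_sin_le_dispersion {ω₂ : ℝ} (hω : 0 ≤ ω₂) (k : ℝ) : |Real.sin k| ≤ dispersion ω₂ k := by
  unfold dispersion
  apply Real.abs_le_sqrt
  nlinarith [Real.sin_sq_add_cos_sq k, sq_nonneg (1 - Real.cos k)]

/-- The group velocity is at most `1` in absolute value. [folklore] -/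
theorem abs_groupVelocity_le_one {ω₂ : ℝ} (hω : 0 < ω₂) (k : ℝ) : |groupVelocity ω₂ k| ≤ 1 := by
  unfold groupVelocity
  rw [abs_div, abs_of_pos (dispersion_pos hω k), div_le_one (dispersion_pos hω k)]
  exact abs_sin_le_dispersion hω.le k

/-- The resolved-delta Jacobian is at most `2`. [folklore] -/
theorem resonanceJacobian_le_two {ω₂ : ℝ} (hω : 0 < ω₂) (k₁ k₂ k₃ : ℝ) :
    resonanceJacobian ω₂ k₁ k₂ k₃ ≤ 2 := by
  unfold resonanceJacobian
  have h1 := abs_groupVelocity_le_one hω k₂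
  have h2 := abs_groupVelocity_le_one hω (k₁ + k₂ - k₃)
  calc |groupVelocity ω₂ k₂ - groupVelocity ω₂ (k₁ + k₂ - k₃)|
      ≤ |groupVelocity ω₂ k₂| + |groupVelocity ω₂ (k₁ + k₂ - k₃)| := abs_sub _ _
    _ ≤ 2 := by linarith

/-- `ω₂ ≤ ω(k)²`. [folklore] -/
theorem le_dispersion_sq {ω₂ : ℝ} (hω : 0 ≤ ω₂) (k : ℝ) : ω₂ ≤ dispersion ω₂ k ^ 2 := by
  rw [dispersion_sq hω]
  linarith [two_mul_one_sub_cos_nonneg k]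

/-- `ω(k)² ≤ ω₂ + 4`. [folklore] -/
theorem dispersion_sq_le {ω₂ : ℝ} (hω : 0 ≤ ω₂) (k : ℝ) : dispersion ω₂ k ^ 2 ≤ ω₂ + 4 := by
  rw [dispersion_sq hω]
  linarith [Real.neg_one_le_cos k]

/-! ### 2. Every term of the resolved energy delta is bounded for `f = sin` -/

/-- Algebraic core of `term_le`: with `J = |s₂/w₂ - s₄/w₄|` (the Jacobian), the identity
`(w₂ + w₄)(s₁ + s₂ - s₃ - s₄) = 4(w₄ s₂ - w₂ s₄)` and the band bounds `wⱼ² ≥ ω₂`, `J ≤ 2`, the term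
`a (w₁w₂w₃w₄)⁻² J⁻¹ (s₁ + s₂ - s₃ - s₄)²` is at most `8a/ω₂³`. [folklore] -/
theorem term_bound_alg {a ω₂ w1 w2 w3 w4 s1 s2 s3 s4 : ℝ} (ha : 0 < a) (hω : 0 < ω₂)
    (h1 : 0 < w1) (h2 : 0 < w2) (h3 : 0 < w3) (h4 : 0 < w4)
    (hw1 : ω₂ ≤ w1 ^ 2) (hw3 : ω₂ ≤ w3 ^ 2) (hs2 : Real.sqrt ω₂ ≤ w2) (hs4 : Real.sqrt ω₂ ≤ w4)
    (hJ2 : |s2 / w2 - s4 / w4| ≤ 2)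
    (hid : (w2 + w4) * (s1 + s2 - s3 - s4) = 4 * (w4 * s2 - w2 * s4)) :
    a / (w1 * w2 * w3 * w4) ^ 2 / |s2 / w2 - s4 / w4| * (s1 + s2 - s3 - s4) ^ 2 ≤
      8 * a / ω₂ ^ 3 := by
  have hK : 0 ≤ 8 * a / ω₂ ^ 3 := by positivity
  have hJ0 : 0 ≤ |s2 / w2 - s4 / w4| := abs_nonneg _
  by_cases hJz : |s2 / w2 - s4 / w4| = 0
  · rw [hJz, div_zero, zero_mul]; exact hK
  have hJpos : 0 < |s2 / w2 - s4 / w4| := lt_of_le_of_ne hJ0 (Ne.symm hJz)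
  have hB : s1 + s2 - s3 - s4 = 4 * (w4 * s2 - w2 * s4) / (w2 + w4) := by
    rw [eq_div_iff (by positivity)]; linarith [hid]
  have hnum : (w4 * s2 - w2 * s4) ^ 2 = (w2 * w4) ^ 2 * |s2 / w2 - s4 / w4| ^ 2 := by
    rw [sq_abs]; field_simp
  generalize |s2 / w2 - s4 / w4| = J at *
  have hBsq : (s1 + s2 - s3 - s4) ^ 2 = 16 * (w2 * w4) ^ 2 * J ^ 2 / (w2 + w4) ^ 2 := by
    rw [hB, div_pow, mul_pow, hnum]; ring
  have hterm : a / (w1 * w2 * w3 * w4) ^ 2 / J * (s1 + s2 - s3 - s4) ^ 2 =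
      16 * a * J / (w1 ^ 2 * w3 ^ 2 * (w2 + w4) ^ 2) := by
    rw [hBsq]; field_simp
  rw [hterm, div_le_div_iff₀ (by positivity) (by positivity)]
  have h24 : 4 * ω₂ ≤ (w2 + w4) ^ 2 := by
    have hsq := Real.sq_sqrt hω.le
    nlinarith [Real.sqrt_nonneg ω₂]
  have hprod : 4 * ω₂ ^ 3 ≤ w1 ^ 2 * w3 ^ 2 * (w2 + w4) ^ 2 := by
    have h13 : ω₂ * ω₂ ≤ w1 ^ 2 * w3 ^ 2 := mul_le_mul hw1 hw3 hω.le (by positivity)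
    have := mul_le_mul h13 h24 (by positivity) (by positivity)
    nlinarith
  calc 16 * a * J * ω₂ ^ 3 ≤ 16 * a * 2 * ω₂ ^ 3 := by gcongr
    _ = 8 * a * (4 * ω₂ ^ 3) := by ring
    _ ≤ 8 * a * (w1 ^ 2 * w3 ^ 2 * (w2 + w4) ^ 2) := by gcongr

/-- **Term bound.** For `ω₂ > 0`, `k₁ ≠ k₃` in the cell and a resonant `k₂`, the on-site (`a = 1`,
`b = 0`) term `w(k₁,k₂,k₃) · (sin k₁ + sin k₂ - sin k₃ - sin k₄)²` of ALS's form is at most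
`8 · (9/16π) / ω₂³`: on the exchange zero the bracket vanishes, elsewhere `sin_bracket_identity`
turns `(bracket)² / |ω'(k₂) - ω'(k₄)|` into `16 |ω'(k₂) - ω'(k₄)| / (ω(k₁)²ω(k₃)²(ω(k₂)+ω(k₄))²)`
times the prefactor. [cite: AokiLukkarinenSpohn2006, §4 after eq. (4.16)] -/
theorem term_le {ω₂ : ℝ} (hω : 0 < ω₂) {k₁ k₃ : ℝ} (hk₁ : k₁ ∈ Ioc (-π) π)
    (hk₃ : k₃ ∈ Ioc (-π) π) (hne : k₁ ≠ k₃) {k₂ : ℝ} (hk₂ : k₂ ∈ resonantSet ω₂ k₁ k₃) :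
    collisionWeight ω₂ 1 0 k₁ k₂ k₃ *
        (Real.sin k₁ + Real.sin k₂ - Real.sin k₃ - Real.sin (k₁ + k₂ - k₃)) ^ 2 ≤
      8 * alsPrefactor / ω₂ ^ 3 := by
  have ha := alsPrefactor_pos
  have hK : 0 ≤ 8 * alsPrefactor / ω₂ ^ 3 := by positivity
  by_cases h23 : k₂ = k₃
  · have : Real.sin k₁ + Real.sin k₂ - Real.sin k₃ - Real.sin (k₁ + k₂ - k₃) = 0 := by
      rw [h23, add_sub_cancel_right]; ring
    rw [this]; simpa using hK
  have hcos := cos_half_ne_of_mem_Ioc hk₁ hk₂.1 hk₃ hne h23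
  have hid := sin_bracket_identity hω hk₂.2 hcos
  have hJ2 := resonanceJacobian_le_two hω k₁ k₂ k₃
  have hw : collisionWeight ω₂ 1 0 k₁ k₂ k₃ = alsPrefactor /
      (dispersion ω₂ k₁ * dispersion ω₂ k₂ * dispersion ω₂ k₃ * dispersion ω₂ (k₁ + k₂ - k₃)) ^ 2 /
        resonanceJacobian ω₂ k₁ k₂ k₃ := by
    unfold collisionWeight vertex; ring
  have hJdef : resonanceJacobian ω₂ k₁ k₂ k₃ =
      |Real.sin k₂ / dispersion ω₂ k₂ -
        Real.sin (k₁ + k₂ - k₃) / dispersion ω₂ (k₁ + k₂ - k₃)| := rfl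
  rw [hJdef] at hw hJ2
  rw [hw]
  exact term_bound_alg ha hω (dispersion_pos hω _) (dispersion_pos hω _) (dispersion_pos hω _)
    (dispersion_pos hω _) (le_dispersion_sq hω.le _) (le_dispersion_sq hω.le _)
    (sqrt_le_dispersion _) (sqrt_le_dispersion _) hJ2 hid

/-! ### 3. The resolved energy delta of `sin` is uniformly bounded; `q(sin) < ∞` -/

/-- **Fibre bound.** The finite sum over the resonant fibre of the on-site terms of `sin` is at most
`12 · 8 (9/16π) / ω₂³` (twelve candidates, `mem_candidates`; zero on the diagonal). [folklore] -/
theorem finsum_term_le {ω₂ : ℝ} (hω : 0 < ω₂) {k₁ k₃ : ℝ} (hk₁ : k₁ ∈ Ioc (-π) π)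
    (hk₃ : k₃ ∈ Ioc (-π) π) :
    ∑ᶠ k₂ ∈ resonantSet ω₂ k₁ k₃, collisionWeight ω₂ 1 0 k₁ k₂ k₃ *
        (Real.sin k₁ + Real.sin k₂ - Real.sin k₃ - Real.sin (k₁ + k₂ - k₃)) ^ 2 ≤
      12 * (8 * alsPrefactor / ω₂ ^ 3) := by
  have ha := alsPrefactor_pos
  have hK : 0 ≤ 8 * alsPrefactor / ω₂ ^ 3 := by positivity
  by_cases hne : k₁ = k₃
  · subst hne
    have h0 : ∀ k₂ : ℝ, collisionWeight ω₂ 1 0 k₁ k₂ k₁ *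
        (Real.sin k₁ + Real.sin k₂ - Real.sin k₁ - Real.sin (k₁ + k₂ - k₁)) ^ 2 = 0 := by
      intro k₂; rw [add_sub_cancel_left]; ring
    simp_rw [h0]
    simp only [finsum_zero]
    positivity
  have hfin := resonantSet_finite hω hk₁ hk₃ hne
  rw [finsum_mem_eq_finite_toFinset_sum _ hfin]
  -- the twelve candidates
  set T₂ : Finset ℝ := {Real.cos ((k₁ + k₃) / 2),
    Real.cos ((k₁ - k₃) / 2) * (dispersion ω₂ k₁ - dispersion ω₂ k₃) ^ 2 /
      (2 * Real.sin ((k₁ - k₃) / 2) ^ 2) - Real.cos ((k₁ + k₃) / 2)} with hT₂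
  set S : Finset ℝ := ((T₂ ×ˢ ({1, -1} : Finset ℝ)) ×ˢ ({-1, 0, 1} : Finset ℝ)).image
    (fun q : (ℝ × ℝ) × ℝ => q.1.2 * Real.arccos q.1.1 - (k₁ - k₃) / 2 + 2 * q.2 * π) with hS
  have hsub : hfin.toFinset ⊆ S := by
    rw [Set.Finite.toFinset_subset]
    intro k₂ hk₂
    obtain ⟨t, ht, σ, hσ, n, hn, hk⟩ := mem_candidates hω hk₁ hk₃ hne hk₂
    rw [hS, Finset.coe_image]
    exact ⟨((t, σ), n), by simp only [Finset.coe_product]; exact ⟨⟨ht, hσ⟩, hn⟩, hk.symm⟩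
  have hcard : (hfin.toFinset).card ≤ 12 := by
    refine (Finset.card_le_card hsub).trans (Finset.card_image_le.trans ?_)
    rw [Finset.card_product, Finset.card_product]
    have h1 : T₂.card ≤ 2 := Finset.card_le_two
    have h2 : ({1, -1} : Finset ℝ).card ≤ 2 := Finset.card_le_two
    have h3 : ({-1, 0, 1} : Finset ℝ).card ≤ 3 := Finset.card_le_three
    calc T₂.card * ({1, -1} : Finset ℝ).card * ({-1, 0, 1} : Finset ℝ).card ≤ 2 * 2 * 3 := by
          gcongr
      _ = 12 := by norm_num
  calc ∑ k₂ ∈ hfin.toFinset, collisionWeight ω₂ 1 0 k₁ k₂ k₃ *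
          (Real.sin k₁ + Real.sin k₂ - Real.sin k₃ - Real.sin (k₁ + k₂ - k₃)) ^ 2
      ≤ ∑ k₂ ∈ hfin.toFinset, 8 * alsPrefactor / ω₂ ^ 3 :=
        Finset.sum_le_sum fun k₂ hk₂ => term_le hω hk₁ hk₃ hne (hfin.mem_toFinset.1 hk₂)
    _ = (hfin.toFinset).card * (8 * alsPrefactor / ω₂ ^ 3) := by
        rw [Finset.sum_const, nsmul_eq_mul]
    _ ≤ 12 * (8 * alsPrefactor / ω₂ ^ 3) :=
        mul_le_mul_of_nonneg_right (by exact_mod_cast hcard) hK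

/-- The cell `(-π, π]` has finite Lebesgue measure. [folklore] -/
theorem volume_cell_lt_top : volume (Ioc (-π) π) < ⊤ := measure_Ioc_lt_top

/-- **`q₁,₀(sin) < ∞`**: ALS's on-site Boltzmann form of the trial function `sin` is finite.
[cite: AokiLukkarinenSpohn2006, §4 after eq. (4.16)] -/
theorem boltzmannForm_sin_lt_top {ω₂ : ℝ} (hω : 0 < ω₂) : boltzmannForm ω₂ 1 0 Real.sin < ⊤ := by
  unfold boltzmannForm
  set K : ℝ := 12 * (8 * alsPrefactor / ω₂ ^ 3)
  have hinner : ∀ k₁ ∈ Ioc (-π) π,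
      (∫⁻ k₃ in Ioc (-π) π, ENNReal.ofReal (∑ᶠ k₂ ∈ resonantSet ω₂ k₁ k₃,
        collisionWeight ω₂ 1 0 k₁ k₂ k₃ *
          (Real.sin k₁ + Real.sin k₂ - Real.sin k₃ - Real.sin (k₁ + k₂ - k₃)) ^ 2)) ≤
        ENNReal.ofReal K * volume (Ioc (-π) π) := by
    intro k₁ hk₁
    calc _ ≤ ∫⁻ _ in Ioc (-π) π, ENNReal.ofReal K :=
          setLIntegral_mono' measurableSet_Ioc fun k₃ hk₃ =>
            ENNReal.ofReal_le_ofReal (finsum_term_le hω hk₁ hk₃)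
      _ = ENNReal.ofReal K * volume (Ioc (-π) π) := setLIntegral_const _ _
  have houter : (∫⁻ k₁ in Ioc (-π) π, ∫⁻ k₃ in Ioc (-π) π,
      ENNReal.ofReal (∑ᶠ k₂ ∈ resonantSet ω₂ k₁ k₃, collisionWeight ω₂ 1 0 k₁ k₂ k₃ *
        (Real.sin k₁ + Real.sin k₂ - Real.sin k₃ - Real.sin (k₁ + k₂ - k₃)) ^ 2)) ≤
      ENNReal.ofReal K * volume (Ioc (-π) π) * volume (Ioc (-π) π) := by
    calc _ ≤ ∫⁻ _ in Ioc (-π) π, ENNReal.ofReal K * volume (Ioc (-π) π) :=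
          setLIntegral_mono' measurableSet_Ioc fun k₁ hk₁ => hinner k₁ hk₁
      _ = _ := setLIntegral_const _ _
  refine ENNReal.mul_lt_top ENNReal.ofReal_lt_top (lt_of_le_of_lt houter ?_)
  exact ENNReal.mul_lt_top (ENNReal.mul_lt_top ENNReal.ofReal_lt_top volume_cell_lt_top)
    volume_cell_lt_top

/-- **`sin` is in the form domain** of `q_{a,b}` for `ω₂ > 0`, `a, b ≥ 0` (vertex comparison
`w_{a,b} ≤ (a+16b)² w_{1,0}`). [folklore] -/
theorem isFormDomain_sin {ω₂ a b : ℝ} (hω : 0 < ω₂) (ha : 0 ≤ a) (hb : 0 ≤ b) :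
    IsFormDomain ω₂ a b Real.sin where
  periodic := Real.sin_periodic
  measurable := Real.measurable_sin
  normSq_lt_top := by
    unfold cellNormSq
    calc ∫⁻ k in Ioc (-π) π, ENNReal.ofReal (Real.sin k ^ 2)
        ≤ ∫⁻ _ in Ioc (-π) π, 1 :=
          setLIntegral_mono' measurableSet_Ioc fun k _ => by
            rw [← ENNReal.ofReal_one]
            exact ENNReal.ofReal_le_ofReal (Real.sin_sq_le_one k)
      _ = volume (Ioc (-π) π) := by rw [setLIntegral_const, one_mul]
      _ < ⊤ := volume_cell_lt_top
  form_lt_top := by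
    have hw : ∀ k₁ k₂ k₃, collisionWeight ω₂ a b k₁ k₂ k₃ ≤
        (a + 16 * b) ^ 2 * collisionWeight ω₂ 1 0 k₁ k₂ k₃ := by
      intro k₁ k₂ k₃
      rw [collisionWeight_eq_vertex_sq_mul ω₂ a b]
      exact mul_le_mul_of_nonneg_right (vertex_sq_le ha hb k₁ k₂ k₃)
        (collisionWeight_nonneg _ _ _ _ _ _)
    calc boltzmannForm ω₂ a b Real.sin
        ≤ ENNReal.ofReal ((a + 16 * b) ^ 2) * boltzmannForm ω₂ 1 0 Real.sin :=
          boltzmannForm_mono_weight hω (sq_nonneg _) hw Real.sin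
      _ < ⊤ := ENNReal.mul_lt_top ENNReal.ofReal_lt_top (boltzmannForm_sin_lt_top hω)

/-! ### 4. The current pairs positively with `sin`; positivity of the variational inverse -/

/-- `⟨ω⁻² sin, sin⟩ = ∫_{(-π,π]} sin²k/ω(k)² dk ≥ π/(ω₂+4) > 0`. [folklore] -/
theorem cellPairing_currentVector_sin_pos {ω₂ : ℝ} (hω : 0 < ω₂) :
    0 < cellPairing (currentVector ω₂) Real.sin := by
  unfold cellPairing currentVector
  have hcont : Continuous fun k => Real.sin k / dispersion ω₂ k ^ 2 * Real.sin k := by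
    have hd : Continuous fun k => dispersion ω₂ k ^ 2 := by
      unfold dispersion; fun_prop
    exact (Real.continuous_sin.div hd fun k => (pow_pos (dispersion_pos hω k) 2).ne').mul
      Real.continuous_sin
  have hle : ∀ k, Real.sin k ^ 2 / (ω₂ + 4) ≤ Real.sin k / dispersion ω₂ k ^ 2 * Real.sin k := by
    intro k
    rw [div_mul_eq_mul_div, ← sq]
    exact div_le_div_of_nonneg_left (sq_nonneg _) (pow_pos (dispersion_pos hω k) 2)
      (dispersion_sq_le hω.le k)
  have hlow : ∫ k in Ioc (-π) π, Real.sin k ^ 2 / (ω₂ + 4) = π / (ω₂ + 4) := by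
    rw [integral_div, ← intervalIntegral.integral_of_le (by linarith [Real.pi_pos] : -π ≤ π),
      integral_sin_sq]
    simp
  have hmono : ∫ k in Ioc (-π) π, Real.sin k ^ 2 / (ω₂ + 4) ≤
      ∫ k in Ioc (-π) π, Real.sin k / dispersion ω₂ k ^ 2 * Real.sin k := by
    apply setIntegral_mono_on _ hcont.integrableOn_Ioc measurableSet_Ioc fun k _ => hle k
    exact (by fun_prop : Continuous fun k => Real.sin k ^ 2 / (ω₂ + 4)).integrableOn_Ioc
  have hpos : 0 < π / (ω₂ + 4) := by positivity
  linarith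

/-- **Positivity of the variational inverse of the current**: `0 < ⟨ω⁻²g, L⁻¹ ω⁻²g⟩` (trial
functions `t · sin`, `t` small). [cite: AokiLukkarinenSpohn2006, eqs. (4.12)-(4.16)] -/
theorem inverseForm_currentVector_pos {ω₂ a b : ℝ} (hω : 0 < ω₂) (ha : 0 ≤ a) (hb : 0 ≤ b) :
    0 < inverseForm ω₂ a b (currentVector ω₂) := by
  have hD := isFormDomain_sin hω ha hb
  set P := cellPairing (currentVector ω₂) Real.sin with hPd
  set Q := (boltzmannForm ω₂ a b Real.sin).toReal with hQd
  have hP : 0 < P := cellPairing_currentVector_sin_pos hω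
  have hQ : 0 ≤ Q := ENNReal.toReal_nonneg
  have h := le_inverseForm ω₂ a b (hD.const_mul (P / (Q + 1))) (currentVector ω₂)
  rw [cellPairing_const_mul, boltzmannForm_const_mul, ENNReal.toReal_mul,
    ENNReal.toReal_ofReal (sq_nonneg _)] at h
  refine lt_of_lt_of_le ?_ h
  rw [ENNReal.ofReal_pos]
  have hQ1 : 0 < Q + 1 := by linarith
  have : 2 * (P / (Q + 1) * P) - (P / (Q + 1)) ^ 2 * Q = P ^ 2 * (Q + 2) / (Q + 1) ^ 2 := by
    field_simp; ring
  rw [← hPd, ← hQd, this]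
  positivity

/-- **Positivity of the kinetic conductivity** for `ω₂ > 0`, `a, b ≥ 0`, `T ≠ 0`.
[cite: AokiLukkarinenSpohn2006, §3 eqs. (3.22)-(3.23)] -/
theorem kineticConductivity_pos {ω₂ a b T : ℝ} (hω : 0 < ω₂) (ha : 0 ≤ a) (hb : 0 ≤ b)
    (hT : T ≠ 0) : 0 < kineticConductivity ω₂ a b T := by
  unfold kineticConductivity
  refine ENNReal.mul_pos ?_ (inverseForm_currentVector_pos hω ha hb).ne'
  rw [← pos_iff_ne_zero, ENNReal.ofReal_pos]
  positivity

end Summit.AtomisticToContinuum.FouriersLaw.Theorems.KineticConductivityFinite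

end
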